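import Summits.AtomisticToContinuum.Crystallization.Theses.NashClassCertificates
import Summits.AtomisticToContinuum.Crystallization.Theorems.NashClassCertificatesNashTwoShellGapNashSeparation
import Summits.AtomisticToContinuum.Crystallization.Theorems.PhononSlackCertificatesCoerciveTwoShellGapPeriodisation
import Summits.AtomisticToContinuum.Crystallization.Theorems.NashClassCertificatesNashTwoShellGapBadPhaseOfTorusGap
import Summits.AtomisticToContinuum.Crystallization.Theorems.NashClassCertificatesNashTwoShellGapDiluteOfCrux
import Summits.AtomisticToContinuum.Crystallization.Theorems.NashClassCertificatesNashTwoShellGapBadFractionOfBadPhaseGap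
import Summits.AtomisticToContinuum.Crystallization.Theorems.PricedLinkCensusStackingHingeEStarStrict
import Summits.AtomisticToContinuum.Crystallization.Theorems.NashClassCertificatesNashTwoShellGapBulkDiluteComposition
import Summits.AtomisticToContinuum.Crystallization.Theorems.NashClassCertificatesNashTwoShellGapCrystallizationOfBadPhaseGap
import Summits.AtomisticToContinuum.Crystallization.Theorems.NashClassCertificatesNashTwoShellGapFiniteCorner
import Summits.AtomisticToContinuum.Crystallization.Theorems.NashClassCertificatesNashTwoShellGapBadPhaseGapImprovementForm
import Summits.AtomisticToContinuum.Crystallization.Theorems.NashClassCertificatesNashTwoShellGapSmallClusterGap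
import Summits.AtomisticToContinuum.Crystallization.Theorems.PhononSlackCertificatesNearFarGlueRLatticeSubset
import HarnessLib

/-!
# Line `bulk_dilute` for crux `NashTwoShellGap` (stmt-AtomisticToContinuum-16826) — PICKED by the continuation lead
# (prover-line-stmt-AtomisticToContinuum-16826-c1-0, cycle c1/1; skeleton authored by crux-strategist s1)

Lead's ownership note: the two load-bearing stubs and the composition are the strategist's, byte-identical; the lead
added the section "Registered API / bookkeeping sub-goals" (`stub_badPhaseOfTorusGap`, `stub_diluteOfCrux`,
`stub_strictFloor`, `stub_badFractionOfBadPhaseGap`) — true statements placing the stubs (torus gap ⇒ bulk; crux ⇒ dilute;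
strict floor; bulk ⇒ o(N) bad fraction of ground states = all the assembly uses), registered for the wave.
Wave 1 (c1/1): `stub_badPhaseOfTorusGap` p161674, `stub_diluteOfCrux` p161631, `stub_badFractionOfBadPhaseGap` p161727 LANDED and cited
below; `stub_strictFloor` was already the tree theorem `PricedHcpWindowsEStarStrict.stub_eStarStrict` (registration expired, cited);
`stub_diluteNashGap` returned `stub-blocked: CoerciveTwoShellGap (13956)` (no weaker existing decl implies it).
Lead landings (c1/1): composition `stub_bulkDiluteComposition` + `nashTwoShellGap_iff_dilute_of_bulk` p162148; the route's
`closes` with the crux replaced by the bulk stub, `stub_crystallizationOfBadPhaseGap` p162206; `stub_finiteCorner` p162411;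
`stub_badPhaseGapImprovementForm` (bulk ⇔ e*-free improvement form) p162509; `stub_smallClusterGap` (certified 1/400 for N ≤ 18)
p162603 — all cited in the section "Landed consequences" below.
Wave 2 (c1/1, Kossel corner = on-lattice shadow of the dilute stub): `stub_fccOccupiedGood` p163552, `stub_fccSiteSums` p163660 LANDED;
the composition `stub_kosselGap` turned out PRE-EXISTING as `PhononSlackCertificatesNearFarGlueR.latticeSubsetGap` (14970 lead), cited.


Crux (route `NashClassCertificates`, rank 2; FIXED): `∃ g > 0, ∀ N x, x 1/3-separated → x Nash for V_LJ →
N·e* + g·#{i : ¬ IsTwoShellGood (1/20) (47/50) 1 x i} ≤ 𝓔_LJ(x)`, `e* = ⨅_Q e(Q)` over periodic `Q`.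

## The line: DENSITY DICHOTOMY — bulk phase competition (Nash-inert, torus, flat gap) × dilute equilibrium defects (Nash-active)

The live line `birth` cuts the bad set by a HOLE test (exposed / jammed) and both of its gap stubs are, as the lead's
landed reductions show (`NashTwoShellGapReductions.jammedBadGap_of_torusTwoShellGap`, worker sub-goal
`stub_exposedOfTorusGap`), consequences of the Nash-FREE two-shell gap on the torus — the residual core of the sister
crux 13956, on which the 13956 lead is stuck.  The Nash hypothesis is not used by that reduction at all.

This line cuts instead by the DENSITY of badness, which is the one seam along which the Nash lever provably separates
(barrier notes N1–N2/B1–B4 of the crux workfiles: finite-move and stationarity cuts are inert at the binding frustrated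
stars, i.e. in the BULK; what Nash buys is the deletion of the non-equilibrium cheap DILUTE populations — rattlers,
frozen waves, threshold-strained grains held by nothing, point defects next to kinks):

* `stub_badPhaseGap` (XL; the shared bulk core in its WEAKEST natural form; Nash-free ON PURPOSE): for every density
  `β₀ > 0` there is a flat gap `γ > 0` such that every periodic configuration of `ℝ³` with `1/3`-separated point set
  whose motif has a fraction `≥ β₀` of `1/20`-bad points (badness read in `P.points`) has `e(P) ≥ e* + γ`.
  Equivalently: minimising sequences of periodic Lennard-Jones configurations become two-shell good IN DENSITY.
  It is implied by the torus two-shell gap of 13956 (`γ := g·β₀`) and is STRICTLY WEAKER as a statement: it carries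
  no linear rate as `β → 0`, i.e. it does not price sparse defects of periodic configurations (the rattler population,
  `g ≲ 2·10⁻³`, sister `Disproof.lean` §5) — that branch is exactly what the Nash class deletes, and it reappears below
  only for EQUILIBRIA.  Why it might fail = why the crux might: a tetrahedrally close-packed / amorphous periodic
  family with bad fraction `≥ β₀` and `e → e*`.  Honest status: this is the energetic core of the summit at two-shell
  resolution (it forces `e*` to be approached only by asymptotically good structures); no line on this crux avoids it
  (see `STRATEGY-CENSUS.md`), this line only refuses to ask MORE than it on the bulk side.
* `stub_diluteNashGap` (XL; where Nash bites; a RESTRICTION of the crux, hence no added falsity risk): there are a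
  density `β₀ > 0` and a price `g > 0` such that every `1/2`-separated Nash configuration with AT MOST `β₀ N` bad
  particles satisfies `N·e* + g·#bad ≤ 𝓔(x)`.  In scope: surfaces and void walls of large good crystals, grain
  boundaries of coarse polycrystals, dislocations, isolated equilibrium point defects and compact Frank–Kasper
  inclusions, bent/strained good crystal near the `1/20` threshold — all EQUILIBRIA (Nash ⇒ force balance, landed
  `stub_nashForceBalance`; on-site stability; Aufbau), with margins `≈ 3·10⁻²–0.7` per bad particle relative to their
  OWN host (`e(host) ≥ e*` makes host-referenced pricing `e*`-free: cards `equilibrium-defect-gap`,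
  `regular-equilibria-strict-lp`), except threshold strain (`κ_CB·θ² ≈ 2.5·10⁻³`, priced by Cauchy–Born + interior
  regularity of equilibria).  Why it might fail: an equilibrium defect of a Barlow host with non-positive formation
  energy per bad particle (none known), or a levy failure (flat boundary charges) if the proof splits good/bad sums
  additively instead of pricing by host-referenced surgery / zero-stress flux.
* `gap_of_bulk_of_dilute` (sorry-free; hypotheses = the two stub STATEMENTS) and `NashTwoShellGap_of` (the crux BY NAME from
  the stubs) — kernel-checked composition: bootstrap `1/3 → 1/2` by the LANDED `stub_nashSeparation`
  (p158426, used as a theorem, not a stub); if `#bad ≤ β₀ N` apply the dilute stub; otherwise periodise `x`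
  (tree: `CoarseTierTransfer.exists_periodicConfiguration`, `separated_points`, `energyPerParticle_le`,
  `CoerciveTwoShellGapPeriodisation.card_bad_le`): the periodisation has `1/3`-separated points, motif of size `N`,
  bad motif fraction `≥ β₀` and `e(P) ≤ 𝓔(x)/N`, so the bulk stub gives `𝓔(x) ≥ N(e* + γ) ≥ N e* + γ·#bad`;
  `g := min g_D γ`.

Neither stub gives the crux alone (an all-bad A15 chunk is out of the dilute stub's scope; a large good crystal with a
surface is out of the bulk stub's bite since its bad fraction `→ 0`), neither is the crux reworded (bulk: Nash-free,
periodic, flat; dilute: density-restricted), and the seam does real work only in the dense case (periodisation).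

Disproof / negatives honoured: sister `coerciveTwoShellGap_false_without_sep` (both stubs keep separation),
`not_coerciveTwoShellGapTol_of_nonpos` (tolerance `1/20` kept; the `ε → 0` witness is a generic perturbation — not
Nash, and periodic only at huge misfit density where the bulk stub's `γ(β₀)` may be as small as it likes),
`gapAt_zero` (the `g = 0` floor is free: both stubs are about the positive part), `violation_squeeze` (a refutation of
either stub needs `e*` from below — same as the crux); negatives index (20): no stub is a shell census (15929), a
linear-in-mismatch pricing (17253), a local-Hales inference (4146) or a one-grain gluing (3506).
-/

noncomputable section

namespace Summit.AtomisticToContinuum.Crystallization.Cruxes.NashTwoShellGap.BulkDilute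

open scoped BigOperators Classical
open Literature.MathematicalPhysics.StatisticalMechanics Literature.Geometry.DiscreteGeometry
open Summit.AtomisticToContinuum.Crystallization.Theorems

/-! ## Registered stubs (sorries live ONLY here; signatures fully qualified, one line each) -/

/-- **STUB B — bad-phase gap on the torus (bulk phase competition; Nash-free; flat gap for bad fraction `≥ β₀`)**
(size XL; the shared energetic core in its weakest form).  For every `β₀ > 0` there is `γ > 0` such that every
periodic configuration `P` of `ℝ³` with `1/3`-separated point set and at least `β₀ · #motif` motif points that are
`1/20`-bad in `P.points` has `e* + γ ≤ e(P)`.  Implied by the torus two-shell gap of crux 13956 (`γ = g β₀`);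
strictly weaker (no rate as `β₀ → 0`).  Why it might fail: a Frank–Kasper / amorphous periodic family with bad
fraction bounded below and `e(P) → e*`. -/
theorem stub_badPhaseGap : ∀ β₀ : ℝ, 0 < β₀ → ∃ γ : ℝ, 0 < γ ∧ ∀ P : Literature.MathematicalPhysics.StatisticalMechanics.PeriodicConfiguration 3, (∀ u ∈ P.points, ∀ v ∈ P.points, u ≠ v → (1 / 3 : ℝ) ≤ dist u v) → β₀ * (P.motif.card : ℝ) ≤ ((P.motif.filter fun y => ¬ Literature.Geometry.DiscreteGeometry.IsTwoShellGoodSet (1 / 20) (47 / 50) 1 P.points y).card : ℝ) → (⨅ Q : Literature.MathematicalPhysics.StatisticalMechanics.PeriodicConfiguration 3, Q.energyPerParticle Literature.MathematicalPhysics.StatisticalMechanics.lennardJones) + γ ≤ P.energyPerParticle Literature.MathematicalPhysics.StatisticalMechanics.lennardJones := by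
  sorry

/-- **STUB D — dilute gap on the Nash class (equilibrium defects; the Nash lever)** (size XL).  There are
`β₀ > 0` and `g > 0` such that every `1/2`-separated finite configuration `x` of `ℝ³` that is Nash for `V_LJ` and
has at most `β₀ · N` bad particles satisfies `N·e* + g·#bad ≤ 𝓔_LJ(x)` (bad = `¬ IsTwoShellGood (1/20) (47/50) 1`).
A restriction of the crux (density-bounded badness, `1/2`-separation from the landed bootstrap).  Why plausibly
true: sparse badness in an equilibrium is a union of equilibrium defects of large good grains (surfaces, void walls,
grain boundaries, dislocations, point defects, compact TCP inclusions, threshold strain), each with positive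
formation energy relative to its own host, and `e(host) ≥ e*` for free.  Why it might fail: an equilibrium defect of
a Barlow host with non-positive formation energy per bad particle; additive good/bad splitting with flat boundary
charges (levy) instead of host-referenced pricing. -/
theorem stub_diluteNashGap : ∃ β₀ : ℝ, 0 < β₀ ∧ ∃ g : ℝ, 0 < g ∧ ∀ (N : ℕ) (x : Fin N → EuclideanSpace ℝ (Fin 3)), (∀ i j : Fin N, i ≠ j → 1 / 2 ≤ dist (x i) (x j)) → (∀ (i : Fin N) (y : EuclideanSpace ℝ (Fin 3)), (∀ j : Fin N, j ≠ i → y ≠ x j) → Literature.MathematicalPhysics.StatisticalMechanics.siteEnergy Literature.MathematicalPhysics.StatisticalMechanics.lennardJones x i ≤ ∑ j ∈ Finset.univ.erase i, Literature.MathematicalPhysics.StatisticalMechanics.lennardJones (dist y (x j))) → (Nat.card {i : Fin N // ¬ Literature.Geometry.DiscreteGeometry.IsTwoShellGood (1 / 20) (47 / 50) 1 x i} : ℝ) ≤ β₀ * N → (N : ℝ) * (⨅ Q : Literature.MathematicalPhysics.StatisticalMechanics.PeriodicConfiguration 3, Q.energyPerParticle Literature.MathematicalPhysics.StatisticalMechanics.lennardJones)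 + g * (Nat.card {i : Fin N // ¬ Literature.Geometry.DiscreteGeometry.IsTwoShellGood (1 / 20) (47 / 50) 1 x i} : ℝ) ≤ Literature.MathematicalPhysics.StatisticalMechanics.interactionEnergy Literature.MathematicalPhysics.StatisticalMechanics.lennardJones x := by
  sorry

/-! ## Registered API / bookkeeping sub-goals of the line (lead c1, cycle 1) — NOT consumed by the composition

These are TRUE, provable statements that place the two load-bearing stubs exactly (sandwiches and bridges) and record
what the line buys; they are registered so that workers may land them `--supports stmt-AtomisticToContinuum-16826`.
-/

/-- **SUB-GOAL (reduction) — the bulk stub is below the torus two-shell gap.**  The torus two-shell gap at tolerance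
`1/20` (the hypothesis of `NashTwoShellGapReductions.nashTwoShellGap_of_torusTwoShellGap`, equivalent to crux 13956 by
`coerciveTwoShellGap_iff_torusTwoShellGap`) implies `stub_badPhaseGap` with `γ := g·β₀` (`#motif > 0`). [folklore] -/
theorem stub_badPhaseOfTorusGap : (∃ g : ℝ, 0 < g ∧ ∀ P : Literature.MathematicalPhysics.StatisticalMechanics.PeriodicConfiguration 3, (∀ u ∈ P.points, ∀ v ∈ P.points, u ≠ v → (1 / 3 : ℝ) ≤ dist u v) → (⨅ Q : Literature.MathematicalPhysics.StatisticalMechanics.PeriodicConfiguration 3, Q.energyPerParticle Literature.MathematicalPhysics.StatisticalMechanics.lennardJones) + g * ((P.motif.filter fun y => ¬ Literature.Geometry.DiscreteGeometry.IsTwoShellGoodSet (1 / 20) (47 / 50) 1 P.points y).card : ℝ) / (P.motif.card : ℝ) ≤ P.energyPerParticle Literature.MathematicalPhysics.StatisticalMechanics.lennardJones) → ∀ β₀ : ℝ, 0 < β₀ → ∃ γ : ℝ, 0 < γ ∧ ∀ P : Literature.MathematicalPhysics.StatisticalMechanics.PeriodicConfiguration 3, (∀ u ∈ P.points, ∀ v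 ∈ P.points, u ≠ v → (1 / 3 : ℝ) ≤ dist u v) → β₀ * (P.motif.card : ℝ) ≤ ((P.motif.filter fun y => ¬ Literature.Geometry.DiscreteGeometry.IsTwoShellGoodSet (1 / 20) (47 / 50) 1 P.points y).card : ℝ) → (⨅ Q : Literature.MathematicalPhysics.StatisticalMechanics.PeriodicConfiguration 3, Q.energyPerParticle Literature.MathematicalPhysics.StatisticalMechanics.lennardJones) + γ ≤ P.energyPerParticle Literature.MathematicalPhysics.StatisticalMechanics.lennardJones :=
  -- CLOSED (wave 1, worker B): landed p161674
  NashTwoShellGapBadPhaseOfTorusGap.stub_badPhaseOfTorusGap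

/-- **SUB-GOAL (sandwich) — the dilute stub is a restriction of the crux.**  `NashTwoShellGap → stub_diluteNashGap`
(`β₀ := 1`, same `g`; `1/2`-separated ⇒ `1/3`-separated), so the line asks nothing false unless the crux is. [folklore] -/
theorem stub_diluteOfCrux : Summit.AtomisticToContinuum.Crystallization.Theses.NashClassCertificates.NashTwoShellGap → ∃ β₀ : ℝ, 0 < β₀ ∧ ∃ g : ℝ, 0 < g ∧ ∀ (N : ℕ) (x : Fin N → EuclideanSpace ℝ (Fin 3)), (∀ i j : Fin N, i ≠ j → 1 / 2 ≤ dist (x i) (x j)) → (∀ (i : Fin N) (y : EuclideanSpace ℝ (Fin 3)), (∀ j : Fin N, j ≠ i → y ≠ x j) → Literature.MathematicalPhysics.StatisticalMechanics.siteEnergy Literature.MathematicalPhysics.StatisticalMechanics.lennardJones x i ≤ ∑ j ∈ Finset.univ.erase i, Literature.MathematicalPhysics.StatisticalMechanics.lennardJones (dist y (x j))) → (Nat.card {i : Fin N // ¬ Literature.Geometry.DiscreteGeometry.IsTwoShellGood (1 / 20) (47 / 50) 1 x i} : ℝ) ≤ β₀ * N → (N : ℝ) * (⨅ Q : Literature.MathematicalPhysics.StatisticalMechanics.PeriodicConfiguration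 3, Q.energyPerParticle Literature.MathematicalPhysics.StatisticalMechanics.lennardJones) + g * (Nat.card {i : Fin N // ¬ Literature.Geometry.DiscreteGeometry.IsTwoShellGood (1 / 20) (47 / 50) 1 x i} : ℝ) ≤ Literature.MathematicalPhysics.StatisticalMechanics.interactionEnergy Literature.MathematicalPhysics.StatisticalMechanics.lennardJones x :=
  -- CLOSED (wave 1, worker C): landed p161631
  NashTwoShellGapDiluteOfCrux.stub_diluteOfCrux

/-- **Strict floor (found PRE-EXISTING in the tree by wave 1, worker D; registration `stub_strictFloor` expired)** — no finite
cluster is a bulk minimiser: `N·e* < 𝓔_LJ(x)` for every injective configuration of `N ≥ 1` points, tree theorem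
`PricedHcpWindowsEStarStrict.stub_eStarStrict` (periodisation with a strict cross term).  Consequence for the line: for every
FIXED `N` the crux / dilute inequality holds with some `g_N > 0`; all content of both gap stubs is uniformity in `N`.
[folklore] -/
theorem strictFloor : ∀ (N : ℕ) (x : Fin N → EuclideanSpace ℝ (Fin 3)), 0 < N → Function.Injective x → (N : ℝ) * (⨅ Q : Literature.MathematicalPhysics.StatisticalMechanics.PeriodicConfiguration 3, Q.energyPerParticle Literature.MathematicalPhysics.StatisticalMechanics.lennardJones) < Literature.MathematicalPhysics.StatisticalMechanics.interactionEnergy Literature.MathematicalPhysics.StatisticalMechanics.lennardJones x :=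
  PricedHcpWindowsEStarStrict.stub_eStarStrict

/-- **SUB-GOAL (bridge to the assembly) — the bulk stub ALONE makes the bad fraction of ground states vanish.**
`stub_badPhaseGap →` along every sequence of Lennard-Jones ground states `#bad(x_N)/N → 0` (if `#bad ≥ β₀ N`
frequently, periodise `x_N`: `e(P_N) ≤ E(N)/N < e* + γ` eventually by `squeeze_tendsto_excess_div`, against
`e(P_N) ≥ e* + γ` from the bulk stub via `card_bad_le`).  This is everything `nashHullBridge_proof` extracts from the
crux (`badFraction_of_nashTwoShellGap`), so the route's `closes` survives with `NashTwoShellGap` replaced by the Nash-free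
flat bad-phase gap. [folklore] -/
theorem stub_badFractionOfBadPhaseGap : (∀ β₀ : ℝ, 0 < β₀ → ∃ γ : ℝ, 0 < γ ∧ ∀ P : Literature.MathematicalPhysics.StatisticalMechanics.PeriodicConfiguration 3, (∀ u ∈ P.points, ∀ v ∈ P.points, u ≠ v → (1 / 3 : ℝ) ≤ dist u v) → β₀ * (P.motif.card : ℝ) ≤ ((P.motif.filter fun y => ¬ Literature.Geometry.DiscreteGeometry.IsTwoShellGoodSet (1 / 20) (47 / 50) 1 P.points y).card : ℝ) → (⨅ Q : Literature.MathematicalPhysics.StatisticalMechanics.PeriodicConfiguration 3, Q.energyPerParticle Literature.MathematicalPhysics.StatisticalMechanics.lennardJones) + γ ≤ P.energyPerParticle Literature.MathematicalPhysics.StatisticalMechanics.lennardJones) → ∀ x : (N : ℕ) → (Fin N → EuclideanSpace ℝ (Fin 3)), (∀ N, Literature.MathematicalPhysics.StatisticalMechanics.IsGroundState Literature.MathematicalPhysics.StatisticalMechanics.lennardJones (x N)) → Filter.Tendsto (fun N : ℕ => (Nat.card {i : Fin N // ¬ Literature.Geometry.DiscreteGeometry.IsTwoShellGood (1 / 20)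 (47 / 50) 1 (x N) i} : ℝ) / N) Filter.atTop (nhds 0) :=
  -- CLOSED (wave 1, worker F): landed p161727
  NashTwoShellGapBadFractionOfBadPhaseGap.stub_badFractionOfBadPhaseGap

/-! ## Landed consequences and corners (lead c1; all ACCEPTED tree theorems, cited by name) -/

/-- **The route survives with the crux replaced by the bulk stub** (p162206): `stub_badPhaseGap → NashNearField →
PeriodicGivenLayered → Crystallization` — the deciding theorem `closes` re-run with `goodWindows_of_badFraction ∘
stub_badFractionOfBadPhaseGap`.  So THIS route needs from the crux only its Nash-free flat bulk part. [folklore] -/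
theorem crystallizationOfBadPhaseGap : (∀ β₀ : ℝ, 0 < β₀ → ∃ γ : ℝ, 0 < γ ∧ ∀ P : Literature.MathematicalPhysics.StatisticalMechanics.PeriodicConfiguration 3, (∀ u ∈ P.points, ∀ v ∈ P.points, u ≠ v → (1 / 3 : ℝ) ≤ dist u v) → β₀ * (P.motif.card : ℝ) ≤ ((P.motif.filter fun y => ¬ Literature.Geometry.DiscreteGeometry.IsTwoShellGoodSet (1 / 20) (47 / 50) 1 P.points y).card : ℝ) → (⨅ Q : Literature.MathematicalPhysics.StatisticalMechanics.PeriodicConfiguration 3, Q.energyPerParticle Literature.MathematicalPhysics.StatisticalMechanics.lennardJones) + γ ≤ P.energyPerParticle Literature.MathematicalPhysics.StatisticalMechanics.lennardJones) → Summit.AtomisticToContinuum.Crystallization.Theses.NashClassCertificates.NashNearField → Summit.AtomisticToContinuum.Crystallization.Theses.NashClassCertificates.PeriodicGivenLayered → _root_.Crystallization :=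
  NashTwoShellGapCrystallizationOfBadPhaseGap.stub_crystallizationOfBadPhaseGap

/-- **Given the bulk stub, the crux IS the dilute Nash gap** (p162148). [folklore] -/
theorem nashTwoShellGap_iff_dilute_of_bulk (hB : ∀ β₀ : ℝ, 0 < β₀ → ∃ γ : ℝ, 0 < γ ∧ ∀ P : Literature.MathematicalPhysics.StatisticalMechanics.PeriodicConfiguration 3, (∀ u ∈ P.points, ∀ v ∈ P.points, u ≠ v → (1 / 3 : ℝ) ≤ dist u v) → β₀ * (P.motif.card : ℝ) ≤ ((P.motif.filter fun y => ¬ Literature.Geometry.DiscreteGeometry.IsTwoShellGoodSet (1 / 20) (47 / 50) 1 P.points y).card : ℝ) → (⨅ Q : Literature.MathematicalPhysics.StatisticalMechanics.PeriodicConfiguration 3, Q.energyPerParticle Literature.MathematicalPhysics.StatisticalMechanics.lennardJones) + γ ≤ P.energyPerParticle Literature.MathematicalPhysics.StatisticalMechanics.lennardJones) : Summit.AtomisticToContinuum.Crystallization.Theses.NashClassCertificates.NashTwoShellGap ↔ (∃ β₀ : ℝ, 0 < β₀ ∧ ∃ g : ℝ, 0 < g ∧ ∀ (N : ℕ) (x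 : Fin N → EuclideanSpace ℝ (Fin 3)), (∀ i j : Fin N, i ≠ j → 1 / 2 ≤ dist (x i) (x j)) → (∀ (i : Fin N) (y : EuclideanSpace ℝ (Fin 3)), (∀ j : Fin N, j ≠ i → y ≠ x j) → Literature.MathematicalPhysics.StatisticalMechanics.siteEnergy Literature.MathematicalPhysics.StatisticalMechanics.lennardJones x i ≤ ∑ j ∈ Finset.univ.erase i, Literature.MathematicalPhysics.StatisticalMechanics.lennardJones (dist y (x j))) → (Nat.card {i : Fin N // ¬ Literature.Geometry.DiscreteGeometry.IsTwoShellGood (1 / 20) (47 / 50) 1 x i} : ℝ) ≤ β₀ * N → (N : ℝ) * (⨅ Q : Literature.MathematicalPhysics.StatisticalMechanics.PeriodicConfiguration 3, Q.energyPerParticle Literature.MathematicalPhysics.StatisticalMechanics.lennardJones) + g * (Nat.card {i : Fin N // ¬ Literature.Geometry.DiscreteGeometry.IsTwoShellGood (1 / 20) (47 / 50) 1 x i} : ℝ) ≤ Literature.MathematicalPhysics.StatisticalMechanics.interactionEnergy Literature.MathematicalPhysics.StatisticalMechanics.lennardJones x) :=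
  NashTwoShellGapBulkDiluteComposition.nashTwoShellGap_iff_dilute_of_bulk hB

/-- **The bulk stub in `e*`-free improvement form** (p162509): every bad-dense periodic `P` is beaten by a uniform
margin by SOME periodic `Q` — a proof of the bulk stub is a uniform improvement/surgery theorem, no value of `e*`
needed. [folklore] -/
theorem badPhaseGapImprovementForm : (∀ β₀ : ℝ, 0 < β₀ → ∃ γ : ℝ, 0 < γ ∧ ∀ P : Literature.MathematicalPhysics.StatisticalMechanics.PeriodicConfiguration 3, (∀ u ∈ P.points, ∀ v ∈ P.points, u ≠ v → (1 / 3 : ℝ) ≤ dist u v) → β₀ * (P.motif.card : ℝ) ≤ ((P.motif.filter fun y => ¬ Literature.Geometry.DiscreteGeometry.IsTwoShellGoodSet (1 / 20) (47 / 50) 1 P.points y).card : ℝ) → (⨅ Q : Literature.MathematicalPhysics.StatisticalMechanics.PeriodicConfiguration 3, Q.energyPerParticle Literature.MathematicalPhysics.StatisticalMechanics.lennardJones) + γ ≤ P.energyPerParticle Literature.MathematicalPhysics.StatisticalMechanics.lennardJones) ↔ (∀ β₀ : ℝ, 0 < β₀ → ∃ γ : ℝ, 0 < γ ∧ ∀ P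 : Literature.MathematicalPhysics.StatisticalMechanics.PeriodicConfiguration 3, (∀ u ∈ P.points, ∀ v ∈ P.points, u ≠ v → (1 / 3 : ℝ) ≤ dist u v) → β₀ * (P.motif.card : ℝ) ≤ ((P.motif.filter fun y => ¬ Literature.Geometry.DiscreteGeometry.IsTwoShellGoodSet (1 / 20) (47 / 50) 1 P.points y).card : ℝ) → ∃ Q : Literature.MathematicalPhysics.StatisticalMechanics.PeriodicConfiguration 3, Q.energyPerParticle Literature.MathematicalPhysics.StatisticalMechanics.lennardJones + γ ≤ P.energyPerParticle Literature.MathematicalPhysics.StatisticalMechanics.lennardJones) :=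
  NashTwoShellGapBadPhaseGapImprovementForm.stub_badPhaseGapImprovementForm

/-- **Finite corner** (p162411): for every `N₀` one price `g > 0` works for all injective configurations of at most
`N₀` points — all content of the crux is uniformity in `N`. [folklore] -/
theorem finiteCorner : ∀ N₀ : ℕ, ∃ g : ℝ, 0 < g ∧ ∀ (N : ℕ) (x : Fin N → EuclideanSpace ℝ (Fin 3)), N ≤ N₀ → Function.Injective x → (N : ℝ) * (⨅ Q : Literature.MathematicalPhysics.StatisticalMechanics.PeriodicConfiguration 3, Q.energyPerParticle Literature.MathematicalPhysics.StatisticalMechanics.lennardJones) + g * (Nat.card {i : Fin N // ¬ Literature.Geometry.DiscreteGeometry.IsTwoShellGood (1 / 20) (47 / 50) 1 x i} : ℝ) ≤ Literature.MathematicalPhysics.StatisticalMechanics.interactionEnergy Literature.MathematicalPhysics.StatisticalMechanics.lennardJones x :=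
  NashTwoShellGapFiniteCorner.stub_finiteCorner

/-- **Certified small-cluster corner** (p162603): every configuration of `N ≤ 18` points pays `1/400` per bad
particle (all bad; `𝓔 ≥ −17N/24`; `e* ≤ −0.711`). [folklore] -/
theorem smallClusterGap : ∀ (N : ℕ) (x : Fin N → EuclideanSpace ℝ (Fin 3)), N ≤ 18 → (N : ℝ) * (⨅ Q : Literature.MathematicalPhysics.StatisticalMechanics.PeriodicConfiguration 3, Q.energyPerParticle Literature.MathematicalPhysics.StatisticalMechanics.lennardJones) + (1 / 400) * (Nat.card {i : Fin N // ¬ Literature.Geometry.DiscreteGeometry.IsTwoShellGood (1 / 20) (47 / 50) 1 x i} : ℝ) ≤ Literature.MathematicalPhysics.StatisticalMechanics.interactionEnergy Literature.MathematicalPhysics.StatisticalMechanics.lennardJones x :=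
  NashTwoShellGapSmallClusterGap.stub_smallClusterGap

-- **Kossel corner, combinatorial half** (wave 2, p163552, tree theorem `NashTwoShellGapFccOccupiedGood.stub_fccOccupiedGood`,
-- module `…Theorems.NashClassCertificatesNashTwoShellGapFccOccupiedGood`): on an fcc lattice `fccD3 a`, `a ∈ [47/50, 1]`, a particle
-- with all `18` two-shell sites occupied is `1/20`-good (exact match).  (Cited by name only, same reason as below.)

-- **Kossel corner, energetic half** (wave 2, p163660, tree theorem `NashTwoShellGapFccSiteSums.stub_fccSiteSums`, module
-- `…Theorems.NashClassCertificatesNashTwoShellGapFccSiteSums`): on `fccD3 a` every site sum is `≥ 2e(fccPC a)` and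
-- `≥ 2e(fccPC a) + 15/768` when a two-shell site is empty.  (Cited by name only: not imported here to keep this workfile's
-- closure on modules already built farm-wide at publication time.)

/-- **Kossel corner = the on-lattice shadow of the dilute stub** (registration `stub_kosselGap` expired: PRE-EXISTING as
`PhononSlackCertificatesNearFarGlueR.latticeSubsetGap`, crux 14970): every injective configuration supported on `fccD3 a`,
`a ∈ [47/50, 1]` (any shape, vacancies, voids; NO Nash hypothesis) pays `15/1536` per bad particle against `N·e*` —
host-referenced pricing with `e* ≤ e(fccPC a)` as the only use of `e*`. [folklore] -/
theorem kosselGap : ∀ (a : ℝ), 47 / 50 ≤ a → a ≤ 1 → ∀ (N : ℕ) (x : Fin N → EuclideanSpace ℝ (Fin 3)), Function.Injective x → (∀ i : Fin N, x i ∈ (Summit.AtomisticToContinuum.Crystallization.Theorems.LayeredLawsSelectHcp.Negative.FccLattice.fccD3 a : Set (EuclideanSpace ℝ (Fin 3)))) → (N : ℝ) * (⨅ Q : Literature.MathematicalPhysics.StatisticalMechanics.PeriodicConfiguration 3, Q.energyPerParticle Literature.MathematicalPhysics.StatisticalMechanics.lennardJones) + (15 / 1536) * (Nat.card {i : Fin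 N // ¬ Literature.Geometry.DiscreteGeometry.IsTwoShellGood (1 / 20) (47 / 50) 1 x i} : ℝ) ≤ Literature.MathematicalPhysics.StatisticalMechanics.interactionEnergy Literature.MathematicalPhysics.StatisticalMechanics.lennardJones x :=
  fun _ h47 h1 _ x hx hL => PhononSlackCertificatesNearFarGlueR.latticeSubsetGap h47 h1 x hx hL

/-! ## The composition (kernel-checked, no `sorry` outside the stubs) -/

/-- **Composition lemma** (the real proof; concludes the crux's BODY so that the by-name theorems below are mere
instances): bulk stub statement → dilute stub statement → the crux inequality.  Bootstrap `1/3 → 1/2` on the Nash class by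
the LANDED theorem `NashTwoShellGapNashSeparation.stub_nashSeparation` (p158426); a configuration with at most `β₀ N` bad
particles is priced by the dilute stub; one with more is periodised (`CoarseTierTransfer.exists_periodicConfiguration`:
motif `= univ.image x`, long periods), its periodisation has `1/3`-separated points (`separated_points`), bad motif
fraction `≥ β₀` (`CoerciveTwoShellGapPeriodisation.card_bad_le`) and `e(P) ≤ 𝓔(x)/N` (`energyPerParticle_le`), so the bulk
stub gives `𝓔(x) ≥ N(e* + γ) ≥ N e* + γ #bad`.  `g := min g_D γ`. -/
theorem gap_of_bulk_of_dilute (hB : ∀ β₀ : ℝ, 0 < β₀ → ∃ γ : ℝ, 0 < γ ∧ ∀ P : Literature.MathematicalPhysics.StatisticalMechanics.PeriodicConfiguration 3, (∀ u ∈ P.points, ∀ v ∈ P.points, u ≠ v → (1 / 3 : ℝ) ≤ dist u v) → β₀ * (P.motif.card : ℝ) ≤ ((P.motif.filter fun y => ¬ Literature.Geometry.DiscreteGeometry.IsTwoShellGoodSet (1 / 20) (47 / 50) 1 P.points y).card : ℝ) → (⨅ Q : Literature.MathematicalPhysics.StatisticalMechanics.PeriodicConfiguration 3, Q.energyPerParticle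 Literature.MathematicalPhysics.StatisticalMechanics.lennardJones) + γ ≤ P.energyPerParticle Literature.MathematicalPhysics.StatisticalMechanics.lennardJones) (hD : ∃ β₀ : ℝ, 0 < β₀ ∧ ∃ g : ℝ, 0 < g ∧ ∀ (N : ℕ) (x : Fin N → EuclideanSpace ℝ (Fin 3)), (∀ i j : Fin N, i ≠ j → 1 / 2 ≤ dist (x i) (x j)) → (∀ (i : Fin N) (y : EuclideanSpace ℝ (Fin 3)), (∀ j : Fin N, j ≠ i → y ≠ x j) → Literature.MathematicalPhysics.StatisticalMechanics.siteEnergy Literature.MathematicalPhysics.StatisticalMechanics.lennardJones x i ≤ ∑ j ∈ Finset.univ.erase i, Literature.MathematicalPhysics.StatisticalMechanics.lennardJones (dist y (x j))) → (Nat.card {i : Fin N // ¬ Literature.Geometry.DiscreteGeometry.IsTwoShellGood (1 / 20) (47 / 50) 1 x i} : ℝ) ≤ β₀ * N → (N : ℝ) * (⨅ Q : Literature.MathematicalPhysics.StatisticalMechanics.PeriodicConfiguration 3, Q.energyPerParticle Literature.MathematicalPhysics.StatisticalMechanics.lennardJones) + g * (Nat.card {i : Fin N // ¬ Literature.Geometry.DiscreteGeometry.IsTwoShellGood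 (1 / 20) (47 / 50) 1 x i} : ℝ) ≤ Literature.MathematicalPhysics.StatisticalMechanics.interactionEnergy Literature.MathematicalPhysics.StatisticalMechanics.lennardJones x) : ∃ g : ℝ, 0 < g ∧ ∀ (N : ℕ) (x : Fin N → EuclideanSpace ℝ (Fin 3)), (∀ i j : Fin N, i ≠ j → 1 / 3 ≤ dist (x i) (x j)) → (∀ (i : Fin N) (y : EuclideanSpace ℝ (Fin 3)), (∀ j : Fin N, j ≠ i → y ≠ x j) → Literature.MathematicalPhysics.StatisticalMechanics.siteEnergy Literature.MathematicalPhysics.StatisticalMechanics.lennardJones x i ≤ ∑ j ∈ Finset.univ.erase i, Literature.MathematicalPhysics.StatisticalMechanics.lennardJones (dist y (x j))) → (N : ℝ) * (⨅ Q : Literature.MathematicalPhysics.StatisticalMechanics.PeriodicConfiguration 3, Q.energyPerParticle Literature.MathematicalPhysics.StatisticalMechanics.lennardJones) + g * (Nat.card {i : Fin N // ¬ Literature.Geometry.DiscreteGeometry.IsTwoShellGood (1 / 20) (47 / 50) 1 x i} : ℝ) ≤ Literature.MathematicalPhysics.StatisticalMechanics.interactionEnergy Literature.MathematicalPhysics.StatisticalMechanics.lennardJones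 x := by
  revert hB hD
  intro hB hD
  obtain ⟨β₀, hβ₀, gD, hgD, hD⟩ := hD
  obtain ⟨γ, hγ, hB⟩ := hB β₀ hβ₀
  refine ⟨min gD γ, lt_min hgD hγ, ?_⟩
  intro N x h3 hnash
  -- (0) separation bootstrap on the Nash class (landed p158426)
  have h2 : ∀ i j : Fin N, i ≠ j → 1 / 2 ≤ dist (x i) (x j) :=
    NashTwoShellGapNashSeparation.stub_nashSeparation N x h3 hnash
  set e : ℝ := ⨅ Q : PeriodicConfiguration 3, Q.energyPerParticle lennardJones with he
  set B : ℕ := Nat.card {i : Fin N // ¬ IsTwoShellGood (1 / 20) (47 / 50) 1 x i} with hBdef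
  have hB0 : (0 : ℝ) ≤ (B : ℝ) := Nat.cast_nonneg _
  have hBN : (B : ℝ) ≤ N := by
    have : B ≤ N := (Finite.card_subtype_le _).trans_eq (Nat.card_fin N)
    exact_mod_cast this
  by_cases hdil : (B : ℝ) ≤ β₀ * N
  · -- (1) dilute: the Nash-class dilute stub, then shrink the price to `min gD γ ≤ gD`
    have eD := hD N x h2 hnash hdil
    have m1 : min gD γ * (B : ℝ) ≤ gD * (B : ℝ) := mul_le_mul_of_nonneg_right (min_le_left gD γ) hB0
    linarith [eD, m1]
  · -- (2) dense: periodise and apply the bulk stub on the torus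
    push Not at hdil
    rcases Nat.eq_zero_or_pos N with hN0 | hN
    · subst hN0
      have hB00 : (B : ℝ) = 0 := by
        have : B ≤ 0 := (Finite.card_subtype_le _).trans_eq (Nat.card_fin 0)
        exact_mod_cast Nat.le_zero.1 this
      simp [interactionEnergy, hB00]
    · have hx : Function.Injective x := CoarseTierTransfer.injective_of_separated h3
      obtain ⟨P, hPm, hPl⟩ := CoarseTierTransfer.exists_periodicConfiguration x hN
      have hsepP := CoarseTierTransfer.separated_points hPm hPl h3
      have hcardm : (P.motif.card : ℝ) = N := by
        rw [hPm, Finset.card_image_of_injective _ hx]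
        simp
      have hcnt : (B : ℝ) ≤
          ((P.motif.filter fun y => ¬ IsTwoShellGoodSet (1 / 20) (47 / 50) 1 P.points y).card : ℝ) := by
        exact_mod_cast CoerciveTwoShellGapPeriodisation.card_bad_le hPm hPl hx
      have hfrac : β₀ * (P.motif.card : ℝ) ≤
          ((P.motif.filter fun y => ¬ IsTwoShellGoodSet (1 / 20) (47 / 50) 1 P.points y).card : ℝ) := by
        rw [hcardm]; linarith
      have key := hB P hsepP hfrac
      have hle := CoarseTierTransfer.energyPerParticle_le hPm hPl hx hN
      have hNr : (0 : ℝ) < N := by exact_mod_cast hN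
      have h4 : e + γ ≤ interactionEnergy lennardJones x / N := key.trans hle
      rw [le_div_iff₀ hNr] at h4
      have m2 : min gD γ * (B : ℝ) ≤ γ * (B : ℝ) := mul_le_mul_of_nonneg_right (min_le_right gD γ) hB0
      have m3 : γ * (B : ℝ) ≤ γ * N := mul_le_mul_of_nonneg_left hBN hγ.le
      nlinarith [h4, m2, m3]


/-- **`bulk_dilute` — the crux BY NAME from the registered stubs** (type literally the route decl; zero hypotheses;
the only `sorry`s in its cone are the declared stubs `stub_badPhaseGap` and `stub_diluteNashGap`, consumed BY NAME through the
sorry-free composition lemma `gap_of_bulk_of_dilute : <bulk stub statement> → <dilute stub statement> → <crux body>`). -/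
theorem NashTwoShellGap_of : Summit.AtomisticToContinuum.Crystallization.Theses.NashClassCertificates.NashTwoShellGap :=
  gap_of_bulk_of_dilute stub_badPhaseGap stub_diluteNashGap

/-- Alias under the `_of_stubs` naming convention of line `birth` (same term). -/
theorem NashTwoShellGap_of_stubs : Summit.AtomisticToContinuum.Crystallization.Theses.NashClassCertificates.NashTwoShellGap :=
  NashTwoShellGap_of

end Summit.AtomisticToContinuum.Crystallization.Cruxes.NashTwoShellGap.BulkDilute

end
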